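import Summits.CriticalPhenomena.PercolationContinuityZ3.Theorems.PercNearOneGluingAdditiveGluingExchangeAvoidMeets
import HarnessLib

/-! # Crux `PercNearOneGluing.AdditiveGluing` (stmt-CriticalPhenomena-4576), line `tieline` —
stub `stub_exchangeAvoidHas_c7`: the two-sided Kozma–Nitzan exchange given `o ∉ C(x)` and
`o ∈ C(y)`

For the bond percolation measure `μ = prodBernoulli w` of a finite weighted graph on `Fin n` and
vertices `x, y, o, b`: if `μ(x ↔ b) ≤ μ(y ↔ b)` then
`μ(x ↔ b, x ↮ y, x ↮ o, y ↔ o) ≤ μ(y ↔ b, x ↮ y, x ↮ o, y ↔ o)` (Kozma–Nitzan, arXiv:2401.12397,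
Lemma 3 (pp. 6–7), parts (i) and (ii) at once, for the mixed conditioning event
`{x ↮ o} ∩ {y ↔ o}`).

## Proof

This is the special case `M = {o}` of the landed stub `stub_exchangeAvoidMeets_c7`
(file `…AdditiveGluingExchangeAvoidMeets.lean`: conditioning on `{x ↮ y} ∩ {x ↮ o} ∩ {y ↔ M}` with
`{y ↔ M} = ⋃_{m ∈ M} {y ↔ m}`), since `⋃_{m ∈ {o}} {y ↔ m} = {y ↔ o}`
(`Finset.set_biUnion_singleton`).
-/

namespace Summit.CriticalPhenomena.PercolationContinuityZ3.Theorems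

open MeasureTheory Set Literature.Probability.LatticeModels Literature.Probability.Percolation

noncomputable section
open Classical

/-- **Two-sided Kozma–Nitzan exchange given `o ∉ C(x)` and `o ∈ C(y)`** (registered stub
`stub_exchangeAvoidHas_c7` of line `tieline`).  If `μ(x ↔ b) ≤ μ(y ↔ b)` for
`μ = prodBernoulli w`, then `μ(x ↔ b, x ↮ y, x ↮ o, y ↔ o) ≤ μ(y ↔ b, x ↮ y, x ↮ o, y ↔ o)`:
the case `M = {o}` of `stub_exchangeAvoidMeets_c7` (the event `{x ↮ y} ∩ {x ↮ o} ∩ {y ↔ o}` is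
increasing in the cluster of `y` and decreasing in the cluster of `x`, so the mixed form of
Lemma 3 — BHK 2006 Thm. 1.5 twice given `{x ↮ y}` — applies with `a₁ = x`, `a₂ = y`, `d = 0`).
[cite: KozmaNitzan2024, Lemma 3 (pp. 6–7)] [cite: VandenbergHaggstromKahn2005, Thm. 1.5 (p. 7)] -/
theorem stub_exchangeAvoidHas_c7 : ∀ (n : ℕ) (w : Sym2 (Fin n) → unitInterval) (x y o b : Fin n),
    (prodBernoulli w).real (openConn x b) ≤ (prodBernoulli w).real (openConn y b) →
    (prodBernoulli w).real (openConn x b ∩ (openConn x y)ᶜ ∩ (openConn x o)ᶜ ∩ openConn y o) ≤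
      (prodBernoulli w).real (openConn y b ∩ (openConn x y)ᶜ ∩ (openConn x o)ᶜ ∩ openConn y o) := by
  intro n w x y o b hle
  have key := stub_exchangeAvoidMeets_c7 n w x y o b {o} hle
  simpa only [Finset.set_biUnion_singleton] using key

end

end Summit.CriticalPhenomena.PercolationContinuityZ3.Theorems
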